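import Literature.Computability.QuantumComplexity.ObliviousAmplification
import HarnessLib

/-!
# The phase-invariant Frobenius distance (numerics of the effective compiler, I)

First of the files building the **effective (polynomial-accuracy) gate compiler** behind the
named fact `PromiseBQPOver_eq_PromiseBQP` (gate-set independence of `PromiseBQP`; hypothesis
`hSK` of `PromiseBQPGateSetIndependence.PromiseBQPOver_eq_PromiseBQP_of`): a brute-force
`ε`-net construction over placement words, run in exact Gaussian-integer arithmetic. The
compiler compares matrices *up to a global phase*; this file supplies the metric it uses and the
bridges to the tree's implementation predicate `ImplOn` (`ApproxImplementation.lean`).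

For matrices `X, Y` on the `m`-qubit register (`Matrix (QReg m) (QReg m) ℂ`):

* `fro X = ‖X‖_F`, the Frobenius (Hilbert–Schmidt) norm, realised as the Euclidean norm of the
  flattened vector `vecOf X : EuclideanSpace ℂ (QReg m × QReg m)` (so the triangle inequality,
  homogeneity and Cauchy–Schwarz are Mathlib's), `finner X Y = ⟨X, Y⟩ = ∑ conj(Xᵢⱼ) Yᵢⱼ`;
  `fro_sq` (sum of squared moduli), `fro_unitary_mul` (`‖U X‖_F = ‖X‖_F`, column by column from
  `l2Norm_mulVec_of_mem_unitaryGroup`), `fro_mul_le` (submultiplicativity), `l2Norm_mulVec_le`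
  (`‖Z ψ‖₂ ≤ ‖Z‖_F ‖ψ‖₂`), entrywise bounds both ways (`norm_apply_le_fro`, `fro_le_card_mul`).
* **The phase-invariant distance** `phaseDist X Y = D(X, Y) = min_{|c|=1} ‖X - cY‖_F` and its
  square `phaseDistSq X Y = Φ(X, Y) = ‖X‖_F² + ‖Y‖_F² - 2|⟨X, Y⟩|` (the closed form the compiler
  evaluates exactly on integers): `Φ ≤ ‖X - cY‖_F²` for every unit `c` (`phaseDistSq_le`) with
  equality at `c = conj⟨X,Y⟩/|⟨X,Y⟩|` (`exists_fro_sub_smul_sq_eq`); hence `D ≥ 0`, symmetry,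
  the **triangle inequality** (`phaseDist_triangle`), **left unitary invariance**
  (`phaseDist_unitary_mul`), the perturbation bound `D(X', Y') ≤ D(X, Y) + ‖X' - X‖_F + ‖Y' - Y‖_F`
  (`phaseDist_le_add_fro`), and the threshold form `D ≤ τ ↔ Φ ≤ τ²`.
* **Bridges**: `‖M - V‖_F ≤ δ ⇒ ImplOn univ M V δ` (`implOn_univ_of_fro_le`);
  `ImplOn univ M V δ ⇒ ‖M - V‖_F ≤ 2ᵐ δ` (`fro_le_of_implOn`, via the basis vectors);
  `D(M, U) ≤ δ ⇒ ∃ c, |c| = 1 ∧ ImplOn univ M (c • U) δ` (`exists_implOn_of_phaseDist_le`, the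
  output format of `GateCompiler.Sound`); and from the `L²`-operator norm in which the
  Solovay–Kitaev theorem of the tree is stated (`PlacementSolovayKitaev.exists_placementWord`):
  `‖M - aU‖ ≤ ε ⇒ D(U, M) ≤ 2ᵐ ε` (`phaseDist_le_of_opNorm_sub_smul_le`).

Everything is elementary linear algebra (Nielsen–Chuang 2010, §2.1.4 Hilbert–Schmidt inner
product; §9.2 on phase-invariant distance measures; §4.5.3 Box 4.1 for `E(U, V)`); no named facts.

Other spellings in the tree and in Mathlib (search note): `fro X = ‖X‖` for Mathlib's scoped
Frobenius norm (`open scoped Matrix.Norms.Frobenius`, `Matrix.frobenius_norm_def`,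
`Matrix.frobenius_norm_mul`; bridge `fro_eq_frobenius_norm` below), and `fro X ^ 2 = hsNormSq X`
(`QuantumComplexity/HilbertSchmidtKraus.lean`, by `fro_sq`; not imported, to keep the import
closure light); the operator-norm bridge to `ImplOn` is the tree's `implOn_of_opNorm_sub_le`
(`ObliviousAmplification.lean`). The flattening `vecOf` (rather than a norm instance on `Matrix`)
is what provides the inner product `finner` and Cauchy–Schwarz without choosing a global matrix
norm, following the `l2Norm` precedent of `HybridArgument.lean`.

## References

* M. A. Nielsen, I. L. Chuang, *Quantum Computation and Quantum Information*, CUP 2010, §2.1.4,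
  §4.5.3 (Box 4.1), §9.2 [NielsenChuang2010].
* C. M. Dawson, M. A. Nielsen, *The Solovay–Kitaev algorithm*, Quantum Inf. Comput. 6 (2006),
  §3 (distance up to phase; nets of `SU(d)`) [DawsonNielsen2006].
-/

noncomputable section

namespace Literature.Computability.QuantumComplexity

open scoped InnerProductSpace ComplexConjugate
open Matrix Cryptography

namespace PhaseFrobenius

variable {m : ℕ}

/-! ### The Frobenius norm through the flattened vector -/

/-- The flattening of a matrix on the `m`-qubit register into a Euclidean vector indexed by
pairs of basis labels. [folklore] -/
def vecOf (X : Matrix (QReg m) (QReg m) ℂ) : EuclideanSpace ℂ (QReg m × QReg m) :=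
  WithLp.toLp 2 fun p => X p.1 p.2

/-- Entries of the flattening. [folklore] -/
@[simp] theorem vecOf_apply (X : Matrix (QReg m) (QReg m) ℂ) (p : QReg m × QReg m) :
    (vecOf X).ofLp p = X p.1 p.2 := rfl

/-- Flattening is additive. [folklore] -/
@[simp] theorem vecOf_add (X Y : Matrix (QReg m) (QReg m) ℂ) : vecOf (X + Y) = vecOf X + vecOf Y := rfl

/-- Flattening commutes with subtraction. [folklore] -/
@[simp] theorem vecOf_sub (X Y : Matrix (QReg m) (QReg m) ℂ) : vecOf (X - Y) = vecOf X - vecOf Y := rfl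

/-- Flattening commutes with scalars. [folklore] -/
@[simp] theorem vecOf_smul (c : ℂ) (X : Matrix (QReg m) (QReg m) ℂ) : vecOf (c • X) = c • vecOf X := rfl

/-- Flattening of zero. [folklore] -/
@[simp] theorem vecOf_zero : vecOf (0 : Matrix (QReg m) (QReg m) ℂ) = 0 := rfl

/-- **The Frobenius norm** `‖X‖_F = (∑ᵢⱼ |Xᵢⱼ|²)^{1/2}`, as the Euclidean norm of the flattening.
[cite: NielsenChuang2010, §2.1.4 (Hilbert–Schmidt inner product)] -/
def fro (X : Matrix (QReg m) (QReg m) ℂ) : ℝ := ‖vecOf X‖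

/-- **The Frobenius (Hilbert–Schmidt) inner product** `⟨X, Y⟩ = ∑ᵢⱼ conj(Xᵢⱼ) Yᵢⱼ = tr(Xᴴ Y)`.
[cite: NielsenChuang2010, §2.1.4 (Hilbert–Schmidt inner product)] -/
def finner (X Y : Matrix (QReg m) (QReg m) ℂ) : ℂ := ⟪vecOf X, vecOf Y⟫_ℂ

/-- `‖X‖_F ≥ 0`. [folklore] -/
theorem fro_nonneg (X : Matrix (QReg m) (QReg m) ℂ) : 0 ≤ fro X := norm_nonneg _

/-- `‖0‖_F = 0`. [folklore] -/
@[simp] theorem fro_zero : fro (0 : Matrix (QReg m) (QReg m) ℂ) = 0 := by simp [fro]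

/-- `‖X‖_F² = ∑ᵢⱼ |Xᵢⱼ|²`. [folklore] -/
theorem fro_sq (X : Matrix (QReg m) (QReg m) ℂ) : fro X ^ 2 = ∑ i, ∑ j, ‖X i j‖ ^ 2 := by
  rw [fro, EuclideanSpace.norm_sq_eq, Fintype.sum_prod_type]
  rfl

/-- `⟨X, Y⟩ = ∑ᵢⱼ conj(Xᵢⱼ) Yᵢⱼ`. [folklore] -/
theorem finner_eq_sum (X Y : Matrix (QReg m) (QReg m) ℂ) : finner X Y = ∑ i, ∑ j, conj (X i j) * Y i j := by
  rw [finner, PiLp.inner_apply, Fintype.sum_prod_type]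
  simp only [vecOf_apply, RCLike.inner_apply']

/-- `‖c X‖_F = |c| ‖X‖_F`. [folklore] -/
theorem fro_smul (c : ℂ) (X : Matrix (QReg m) (QReg m) ℂ) : fro (c • X) = ‖c‖ * fro X := by
  rw [fro, vecOf_smul, norm_smul]; rfl

/-- `‖-X‖_F = ‖X‖_F`. [folklore] -/
theorem fro_neg (X : Matrix (QReg m) (QReg m) ℂ) : fro (-X) = fro X := by
  have h : -X = (-1 : ℂ) • X := by simp
  rw [h, fro_smul]; simp

/-- `‖X - Y‖_F = ‖Y - X‖_F`. [folklore] -/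
theorem fro_sub_comm (X Y : Matrix (QReg m) (QReg m) ℂ) : fro (X - Y) = fro (Y - X) := by
  rw [← fro_neg, neg_sub]

/-- Triangle inequality. [folklore] -/
theorem fro_add_le (X Y : Matrix (QReg m) (QReg m) ℂ) : fro (X + Y) ≤ fro X + fro Y := by
  rw [fro, vecOf_add]; exact norm_add_le _ _

/-- Triangle inequality through an intermediate matrix. [folklore] -/
theorem fro_sub_le (X Y Z : Matrix (QReg m) (QReg m) ℂ) : fro (X - Z) ≤ fro (X - Y) + fro (Y - Z) := by
  have h : X - Z = (X - Y) + (Y - Z) := by abel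
  rw [h]; exact fro_add_le _ _

/-- `‖X‖_F ≤ ‖X - Y‖_F + ‖Y‖_F`. [folklore] -/
theorem fro_le_fro_sub_add (X Y : Matrix (QReg m) (QReg m) ℂ) : fro X ≤ fro (X - Y) + fro Y := by
  simpa using fro_sub_le X Y 0

/-- `‖X i j‖² ≤ ‖X‖_F²`. [folklore] -/
theorem norm_apply_sq_le_fro_sq (X : Matrix (QReg m) (QReg m) ℂ) (i j : QReg m) : ‖X i j‖ ^ 2 ≤ fro X ^ 2 := by
  rw [fro_sq]
  refine le_trans ?_ (Finset.single_le_sum (f := fun i => ∑ j, ‖X i j‖ ^ 2)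
    (fun _ _ => Finset.sum_nonneg fun _ _ => by positivity) (Finset.mem_univ i))
  exact Finset.single_le_sum (f := fun j => ‖X i j‖ ^ 2) (fun _ _ => by positivity) (Finset.mem_univ j)

/-- An entry is bounded by the Frobenius norm. [folklore] -/
theorem norm_apply_le_fro (X : Matrix (QReg m) (QReg m) ℂ) (i j : QReg m) : ‖X i j‖ ≤ fro X :=
  le_of_pow_le_pow_left₀ two_ne_zero (fro_nonneg X) (norm_apply_sq_le_fro_sq X i j)

/-- **Entrywise bounds give a Frobenius bound**: `|Xᵢⱼ| ≤ b` for all `i, j` gives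
`‖X‖_F ≤ 2ᵐ · b`. [folklore] -/
theorem fro_le_card_mul (X : Matrix (QReg m) (QReg m) ℂ) {b : ℝ} (hb : 0 ≤ b) (h : ∀ i j, ‖X i j‖ ≤ b) :
    fro X ≤ Fintype.card (QReg m) * b := by
  have h2 : fro X ^ 2 ≤ (Fintype.card (QReg m) * b) ^ 2 := by
    rw [fro_sq]
    calc ∑ i, ∑ j, ‖X i j‖ ^ 2 ≤ ∑ _i : QReg m, ∑ _j : QReg m, b ^ 2 :=
          Finset.sum_le_sum fun i _ => Finset.sum_le_sum fun j _ =>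
            pow_le_pow_left₀ (norm_nonneg _) (h i j) 2
      _ = (Fintype.card (QReg m) * b) ^ 2 := by
          simp only [Finset.sum_const, Finset.card_univ]; ring
  exact le_of_pow_le_pow_left₀ two_ne_zero (by positivity) h2

/-- **Cauchy–Schwarz**: `|⟨X, Y⟩| ≤ ‖X‖_F ‖Y‖_F`. [folklore] -/
theorem norm_finner_le (X Y : Matrix (QReg m) (QReg m) ℂ) : ‖finner X Y‖ ≤ fro X * fro Y := norm_inner_le_norm _ _

/-- `|⟨X, Y⟩| = |⟨Y, X⟩|`. [folklore] -/
theorem norm_finner_comm (X Y : Matrix (QReg m) (QReg m) ℂ) : ‖finner X Y‖ = ‖finner Y X‖ := norm_inner_symm _ _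

/-! ### Columns; invariance under unitaries; action on vectors -/

/-- The `j`-th column of `X`. [folklore] -/
def col (X : Matrix (QReg m) (QReg m) ℂ) (j : QReg m) : QReg m → ℂ := fun i => X i j

/-- `‖X‖_F² = ∑ⱼ ‖column j‖₂²`. [folklore] -/
theorem fro_sq_eq_sum_normSq_col (X : Matrix (QReg m) (QReg m) ℂ) :
    fro X ^ 2 = ∑ j, Cryptography.normSq (col X j) := by
  rw [fro_sq, Finset.sum_comm]
  refine Finset.sum_congr rfl fun j _ => ?_
  simp [Cryptography.normSq, col]

/-- Columns of a product: `col (U X) j = U (col X j)`. [folklore] -/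
theorem col_mul (U X : Matrix (QReg m) (QReg m) ℂ) (j : QReg m) : col (U * X) j = U *ᵥ col X j := by
  funext i
  simp [col, Matrix.mul_apply, Matrix.mulVec, dotProduct]

/-- Columns of a difference. [folklore] -/
theorem col_sub (X Y : Matrix (QReg m) (QReg m) ℂ) (j : QReg m) : col (X - Y) j = col X j - col Y j := rfl

/-- **Left unitary invariance of the Frobenius norm**: `‖U X‖_F = ‖X‖_F` for unitary `U` (each
column is rotated by `U`). [cite: NielsenChuang2010, §2.1.4] -/
theorem fro_unitary_mul {U : Matrix (QReg m) (QReg m) ℂ} (hU : U ∈ Matrix.unitaryGroup (QReg m) ℂ)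
    (X : Matrix (QReg m) (QReg m) ℂ) : fro (U * X) = fro X := by
  have h : fro (U * X) ^ 2 = fro X ^ 2 := by
    rw [fro_sq_eq_sum_normSq_col, fro_sq_eq_sum_normSq_col]
    refine Finset.sum_congr rfl fun j _ => ?_
    rw [col_mul, ← l2Norm_sq, ← l2Norm_sq, l2Norm_mulVec_of_mem_unitaryGroup hU]
  exact (pow_left_inj₀ (fro_nonneg _) (fro_nonneg _) two_ne_zero).1 h

/-- **The Frobenius norm bounds the action on vectors**: `‖Z ψ‖₂ ≤ ‖Z‖_F ‖ψ‖₂` (Cauchy–Schwarz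
row by row). [folklore] -/
theorem l2Norm_mulVec_le (Z : Matrix (QReg m) (QReg m) ℂ) (ψ : QReg m → ℂ) :
    l2Norm (Z *ᵥ ψ) ≤ fro Z * l2Norm ψ := by
  have hrow : ∀ i, ‖(Z *ᵥ ψ) i‖ ^ 2 ≤ (∑ j, ‖Z i j‖ ^ 2) * l2Norm ψ ^ 2 := by
    intro i
    -- `(Z ψ)ᵢ = ⟨conj (row i), ψ⟩`
    have h1 : (Z *ᵥ ψ) i = ⟪(WithLp.toLp 2 fun j => conj (Z i j) : EuclideanSpace ℂ (QReg m)),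
        (WithLp.toLp 2 ψ : EuclideanSpace ℂ (QReg m))⟫_ℂ := by
      rw [PiLp.inner_apply]
      simp [Matrix.mulVec, dotProduct, mul_comm]
    have h2 : ‖(WithLp.toLp 2 fun j => conj (Z i j) : EuclideanSpace ℂ (QReg m))‖ ^ 2 = ∑ j, ‖Z i j‖ ^ 2 := by
      rw [EuclideanSpace.norm_sq_eq]
      simp
    rw [h1]
    calc ‖⟪(WithLp.toLp 2 fun j => conj (Z i j) : EuclideanSpace ℂ (QReg m)), (WithLp.toLp 2 ψ)⟫_ℂ‖ ^ 2
        ≤ (‖(WithLp.toLp 2 fun j => conj (Z i j) : EuclideanSpace ℂ (QReg m))‖ * ‖(WithLp.toLp 2 ψ : EuclideanSpace ℂ (QReg m))‖) ^ 2 :=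
          pow_le_pow_left₀ (norm_nonneg _) (norm_inner_le_norm _ _) 2
      _ = (∑ j, ‖Z i j‖ ^ 2) * l2Norm ψ ^ 2 := by rw [mul_pow, h2]; rfl
  have hsq : l2Norm (Z *ᵥ ψ) ^ 2 ≤ (fro Z * l2Norm ψ) ^ 2 := by
    rw [l2Norm_sq, mul_pow, fro_sq, Finset.sum_mul]
    exact Finset.sum_le_sum fun i _ => hrow i
  exact le_of_pow_le_pow_left₀ two_ne_zero (mul_nonneg (fro_nonneg _) (l2Norm_nonneg _)) hsq

/-- **A Frobenius bound is an implementation bound**: `‖M - V‖_F ≤ δ` gives `ImplOn univ M V δ`.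
[cite: NielsenChuang2010, §4.5.3 Box 4.1] -/
theorem implOn_univ_of_fro_le {M V : Matrix (QReg m) (QReg m) ℂ} {δ : ℝ} (h : fro (M - V) ≤ δ) :
    ImplOn Set.univ M V δ := fun ψ _ => by
  rw [← Matrix.sub_mulVec]
  exact (l2Norm_mulVec_le _ ψ).trans (mul_le_mul_of_nonneg_right h (l2Norm_nonneg ψ))

/-- **An implementation bound is a Frobenius bound up to `√(2ᵐ)`**: `ImplOn univ M V δ` gives
`‖M - V‖_F² ≤ 2ᵐ δ²` (apply the bound to the basis vectors, i.e. to the columns). [folklore] -/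
theorem fro_sq_le_of_implOn {M V : Matrix (QReg m) (QReg m) ℂ} {δ : ℝ} (h : ImplOn Set.univ M V δ) :
    fro (M - V) ^ 2 ≤ Fintype.card (QReg m) * δ ^ 2 := by
  rw [fro_sq_eq_sum_normSq_col]
  calc ∑ j, Cryptography.normSq (col (M - V) j) ≤ ∑ _j : QReg m, δ ^ 2 := Finset.sum_le_sum fun j _ => by
        have hj := h (basisState j) (suppIn_univ _)
        have h1 : l2Norm (basisState j) = 1 := by rw [l2Norm_eq_sqrt_normSq, normSq_basisState, Real.sqrt_one]
        rw [h1, mul_one] at hj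
        have hcol : col (M - V) j = M *ᵥ basisState j - V *ᵥ basisState j := by
          rw [← Matrix.sub_mulVec]; funext i
          simp [col, basisState, Matrix.mulVec, dotProduct, Pi.single_apply]
        rw [← l2Norm_sq, hcol]
        exact pow_le_pow_left₀ (l2Norm_nonneg _) hj 2
    _ = Fintype.card (QReg m) * δ ^ 2 := by simp

/-- `ImplOn univ M V δ` gives `‖M - V‖_F ≤ 2ᵐ δ` (crude form of `fro_sq_le_of_implOn`,
`√(2ᵐ) ≤ 2ᵐ`). [folklore] -/
theorem fro_le_of_implOn {M V : Matrix (QReg m) (QReg m) ℂ} {δ : ℝ} (hδ : 0 ≤ δ) (h : ImplOn Set.univ M V δ) :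
    fro (M - V) ≤ Fintype.card (QReg m) * δ := by
  have h1 := fro_sq_le_of_implOn h
  have hc : (1 : ℝ) ≤ Fintype.card (QReg m) := by exact_mod_cast Fintype.card_pos
  have h2 : (Fintype.card (QReg m) : ℝ) * δ ^ 2 ≤ (Fintype.card (QReg m) * δ) ^ 2 := by
    rw [mul_pow, sq]; nlinarith [sq_nonneg δ]
  exact le_of_pow_le_pow_left₀ two_ne_zero (by positivity) (h1.trans h2)


/-- **Submultiplicativity**: `‖X Y‖_F ≤ ‖X‖_F ‖Y‖_F` (column by column). [folklore] -/
theorem fro_mul_le (X Y : Matrix (QReg m) (QReg m) ℂ) : fro (X * Y) ≤ fro X * fro Y := by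
  have h : fro (X * Y) ^ 2 ≤ (fro X * fro Y) ^ 2 := by
    rw [fro_sq_eq_sum_normSq_col, mul_pow, fro_sq_eq_sum_normSq_col Y, Finset.mul_sum]
    refine Finset.sum_le_sum fun j _ => ?_
    rw [col_mul, ← l2Norm_sq, ← l2Norm_sq, ← mul_pow]
    exact pow_le_pow_left₀ (l2Norm_nonneg _) (l2Norm_mulVec_le X (col Y j)) 2
  exact le_of_pow_le_pow_left₀ two_ne_zero (mul_nonneg (fro_nonneg _) (fro_nonneg _)) h

/-- The identity has Frobenius norm `√(2ᵐ) ≤ 2ᵐ`. [folklore] -/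
theorem fro_one_le : fro (1 : Matrix (QReg m) (QReg m) ℂ) ≤ Fintype.card (QReg m) :=
  le_trans (fro_le_card_mul 1 zero_le_one fun i j => by
    rw [Matrix.one_apply]; split_ifs <;> simp) (by simp)

/-- A unitary has Frobenius norm at most `2ᵐ` (`= √(2ᵐ)` in fact). [folklore] -/
theorem fro_le_card_of_mem_unitaryGroup {U : Matrix (QReg m) (QReg m) ℂ}
    (hU : U ∈ Matrix.unitaryGroup (QReg m) ℂ) : fro U ≤ Fintype.card (QReg m) := by
  have h := fro_unitary_mul hU 1
  rw [Matrix.mul_one] at h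
  rw [h]; exact fro_one_le

/-! ### The phase-invariant distance -/

/-- **The squared phase-invariant Frobenius distance**
`Φ(X, Y) = ‖X‖_F² + ‖Y‖_F² - 2 |⟨X, Y⟩| = min_{|c| = 1} ‖X - c Y‖_F²` — a polynomial expression in
the entries (up to one modulus), which is what the net compiler evaluates exactly on Gaussian
integers. [cite: NielsenChuang2010, §9.2 (phase-invariant distance measures)] -/
def phaseDistSq (X Y : Matrix (QReg m) (QReg m) ℂ) : ℝ := fro X ^ 2 + fro Y ^ 2 - 2 * ‖finner X Y‖

/-- **The phase-invariant Frobenius distance** `D(X, Y) = min_{|c|=1} ‖X - c Y‖_F`. [cite: NielsenChuang2010, §9.2] -/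
def phaseDist (X Y : Matrix (QReg m) (QReg m) ℂ) : ℝ := Real.sqrt (phaseDistSq X Y)

/-- `‖X - c Y‖_F² = ‖X‖_F² + ‖Y‖_F² - 2 Re(c ⟨X, Y⟩)` for a unit `c`. [folklore] -/
theorem fro_sub_smul_sq {c : ℂ} (hc : ‖c‖ = 1) (X Y : Matrix (QReg m) (QReg m) ℂ) :
    fro (X - c • Y) ^ 2 = fro X ^ 2 + fro Y ^ 2 - 2 * (c * finner X Y).re := by
  rw [fro, vecOf_sub, vecOf_smul, @norm_sub_sq ℂ, inner_smul_right, norm_smul, hc, one_mul, RCLike.re_to_complex]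
  simp only [fro, finner]
  ring

/-- **`Φ` is a lower bound**: `Φ(X, Y) ≤ ‖X - c Y‖_F²` for every unit `c`. [folklore] -/
theorem phaseDistSq_le {c : ℂ} (hc : ‖c‖ = 1) (X Y : Matrix (QReg m) (QReg m) ℂ) :
    phaseDistSq X Y ≤ fro (X - c • Y) ^ 2 := by
  rw [fro_sub_smul_sq hc, phaseDistSq]
  have h : (c * finner X Y).re ≤ ‖finner X Y‖ := by
    refine (Complex.re_le_norm _).trans ?_
    rw [norm_mul, hc, one_mul]
  linarith

/-- **`Φ` is attained**: some unit `c` has `‖X - c Y‖_F² = Φ(X, Y)` (`c = conj⟨X,Y⟩/|⟨X,Y⟩|`).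
[folklore] -/
theorem exists_fro_sub_smul_sq_eq (X Y : Matrix (QReg m) (QReg m) ℂ) :
    ∃ c : ℂ, ‖c‖ = 1 ∧ fro (X - c • Y) ^ 2 = phaseDistSq X Y := by
  set s := finner X Y with hs
  by_cases h0 : s = 0
  · refine ⟨1, norm_one, ?_⟩
    rw [fro_sub_smul_sq norm_one, phaseDistSq, ← hs, h0]
    simp
  · have hn : (‖s‖ : ℂ) ≠ 0 := by exact_mod_cast (norm_ne_zero_iff.2 h0)
    refine ⟨conj s / ‖s‖, ?_, ?_⟩
    · rw [norm_div, Complex.norm_conj, Complex.norm_real, Real.norm_eq_abs, abs_of_nonneg (norm_nonneg _),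
        div_self (norm_ne_zero_iff.2 h0)]
    · rw [fro_sub_smul_sq, phaseDistSq, ← hs]
      · have hcs : conj s / ‖s‖ * s = ‖s‖ := by
          rw [div_mul_eq_mul_div, Complex.conj_mul', sq, mul_div_assoc, div_self hn, mul_one]
        rw [hcs, Complex.ofReal_re]
      · rw [norm_div, Complex.norm_conj, Complex.norm_real, Real.norm_eq_abs, abs_of_nonneg (norm_nonneg _),
          div_self (norm_ne_zero_iff.2 h0)]

/-- `Φ(X, Y) ≥ 0`. [folklore] -/
theorem phaseDistSq_nonneg (X Y : Matrix (QReg m) (QReg m) ℂ) : 0 ≤ phaseDistSq X Y := by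
  obtain ⟨c, -, hc⟩ := exists_fro_sub_smul_sq_eq X Y
  rw [← hc]; positivity

/-- `D(X, Y) ≥ 0`. [folklore] -/
theorem phaseDist_nonneg (X Y : Matrix (QReg m) (QReg m) ℂ) : 0 ≤ phaseDist X Y := Real.sqrt_nonneg _

/-- `D(X, Y)² = Φ(X, Y)`. [folklore] -/
theorem phaseDist_sq (X Y : Matrix (QReg m) (QReg m) ℂ) : phaseDist X Y ^ 2 = phaseDistSq X Y :=
  Real.sq_sqrt (phaseDistSq_nonneg X Y)

/-- **`D(X, Y) ≤ ‖X - c Y‖_F`** for every unit `c`. [folklore] -/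
theorem phaseDist_le {c : ℂ} (hc : ‖c‖ = 1) (X Y : Matrix (QReg m) (QReg m) ℂ) :
    phaseDist X Y ≤ fro (X - c • Y) :=
  le_of_pow_le_pow_left₀ two_ne_zero (fro_nonneg _) (by rw [phaseDist_sq]; exact phaseDistSq_le hc X Y)

/-- **The minimising phase**: some unit `c` has `‖X - c Y‖_F = D(X, Y)`. [folklore] -/
theorem exists_fro_sub_smul_eq (X Y : Matrix (QReg m) (QReg m) ℂ) :
    ∃ c : ℂ, ‖c‖ = 1 ∧ fro (X - c • Y) = phaseDist X Y := by
  obtain ⟨c, hc, h⟩ := exists_fro_sub_smul_sq_eq X Y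
  exact ⟨c, hc, (pow_left_inj₀ (fro_nonneg _) (phaseDist_nonneg _ _) two_ne_zero).1 (by rw [h, phaseDist_sq])⟩

/-- `D(X, Y) ≤ ‖X - Y‖_F`. [folklore] -/
theorem phaseDist_le_fro_sub (X Y : Matrix (QReg m) (QReg m) ℂ) : phaseDist X Y ≤ fro (X - Y) := by
  simpa using phaseDist_le norm_one X Y

/-- `D(X, X) = 0`. [folklore] -/
@[simp] theorem phaseDist_self (X : Matrix (QReg m) (QReg m) ℂ) : phaseDist X X = 0 :=
  le_antisymm (by simpa using phaseDist_le_fro_sub X X) (phaseDist_nonneg X X)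

/-- **Symmetry**: `D(X, Y) = D(Y, X)`. [folklore] -/
theorem phaseDist_comm (X Y : Matrix (QReg m) (QReg m) ℂ) : phaseDist X Y = phaseDist Y X := by
  rw [phaseDist, phaseDist, phaseDistSq, phaseDistSq, norm_finner_comm]; ring_nf

/-- **Triangle inequality** for the phase-invariant distance. [folklore] -/
theorem phaseDist_triangle (X Y Z : Matrix (QReg m) (QReg m) ℂ) :
    phaseDist X Z ≤ phaseDist X Y + phaseDist Y Z := by
  obtain ⟨c₁, hc₁, h₁⟩ := exists_fro_sub_smul_eq X Y
  obtain ⟨c₂, hc₂, h₂⟩ := exists_fro_sub_smul_eq Y Z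
  have hc : ‖c₁ * c₂‖ = 1 := by rw [norm_mul, hc₁, hc₂, mul_one]
  calc phaseDist X Z ≤ fro (X - (c₁ * c₂) • Z) := phaseDist_le hc X Z
    _ ≤ fro (X - c₁ • Y) + fro (c₁ • Y - (c₁ * c₂) • Z) := fro_sub_le _ _ _
    _ = phaseDist X Y + phaseDist Y Z := by
        rw [h₁, mul_smul, ← smul_sub, fro_smul, hc₁, one_mul, h₂]

/-- **Perturbation**: `D(X', Y') ≤ D(X, Y) + ‖X' - X‖_F + ‖Y' - Y‖_F`. [folklore] -/
theorem phaseDist_le_add_fro (X Y X' Y' : Matrix (QReg m) (QReg m) ℂ) :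
    phaseDist X' Y' ≤ phaseDist X Y + fro (X' - X) + fro (Y' - Y) := by
  obtain ⟨c, hc, h⟩ := exists_fro_sub_smul_eq X Y
  calc phaseDist X' Y' ≤ fro (X' - c • Y') := phaseDist_le hc X' Y'
    _ ≤ fro (X' - X) + fro (X - c • Y') := fro_sub_le _ _ _
    _ ≤ fro (X' - X) + (fro (X - c • Y) + fro (c • Y - c • Y')) := by gcongr; exact fro_sub_le _ _ _
    _ = phaseDist X Y + fro (X' - X) + fro (Y' - Y) := by
        rw [h, ← smul_sub, fro_smul, hc, one_mul, fro_sub_comm Y Y']; ring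

/-- **Left unitary invariance**: `D(U X, U Y) = D(X, Y)` for unitary `U`. [folklore] -/
theorem phaseDist_unitary_mul {U : Matrix (QReg m) (QReg m) ℂ} (hU : U ∈ Matrix.unitaryGroup (QReg m) ℂ)
    (X Y : Matrix (QReg m) (QReg m) ℂ) : phaseDist (U * X) (U * Y) = phaseDist X Y := by
  apply le_antisymm
  · obtain ⟨c, hc, h⟩ := exists_fro_sub_smul_eq X Y
    calc phaseDist (U * X) (U * Y) ≤ fro (U * X - c • (U * Y)) := phaseDist_le hc _ _
      _ = phaseDist X Y := by rw [← Matrix.mul_smul, ← Matrix.mul_sub, fro_unitary_mul hU, h]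
  · obtain ⟨c, hc, h⟩ := exists_fro_sub_smul_eq (U * X) (U * Y)
    calc phaseDist X Y ≤ fro (X - c • Y) := phaseDist_le hc _ _
      _ = phaseDist (U * X) (U * Y) := by rw [← h, ← Matrix.mul_smul, ← Matrix.mul_sub, fro_unitary_mul hU]

/-- **From the distance to an implementation up to phase**: `D(M, U) ≤ δ` gives a unit `c` with
`ImplOn univ M (c • U) δ`. [cite: NielsenChuang2010, §4.5.3 Box 4.1] -/
theorem exists_implOn_of_phaseDist_le {M U : Matrix (QReg m) (QReg m) ℂ} {δ : ℝ} (h : phaseDist M U ≤ δ) :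
    ∃ c : ℂ, ‖c‖ = 1 ∧ ImplOn Set.univ M (c • U) δ := by
  obtain ⟨c, hc, hcU⟩ := exists_fro_sub_smul_eq M U
  exact ⟨c, hc, implOn_univ_of_fro_le (hcU.symm ▸ h)⟩

/-- **From an approximation up to phase to the distance**: `‖M - a U‖_F ≤ δ` with `‖a‖ = 1`
gives `D(U, M) ≤ δ`. [folklore] -/
theorem phaseDist_le_of_fro_sub_smul_le {M U : Matrix (QReg m) (QReg m) ℂ} {a : ℂ} (ha : ‖a‖ = 1) {δ : ℝ}
    (h : fro (M - a • U) ≤ δ) : phaseDist U M ≤ δ := by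
  rw [phaseDist_comm]
  exact (phaseDist_le ha M U).trans h

/-- The threshold form used by the integer test: for `τ ≥ 0`, `D(X, Y) ≤ τ ↔ Φ(X, Y) ≤ τ²`. [folklore] -/
theorem phaseDist_le_iff_sq_le {X Y : Matrix (QReg m) (QReg m) ℂ} {τ : ℝ} (hτ : 0 ≤ τ) :
    phaseDist X Y ≤ τ ↔ phaseDistSq X Y ≤ τ ^ 2 := by
  rw [← phaseDist_sq]
  exact (pow_le_pow_iff_left₀ (phaseDist_nonneg X Y) hτ two_ne_zero).symm


/-! ### From the operator norm -/

section OpNorm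

open scoped Matrix.Norms.L2Operator

/-- **An operator-norm approximation up to phase bounds the phase-invariant distance**:
`‖M - a U‖ ≤ ε` (operator norm, `‖a‖ = 1`, as produced by the Solovay–Kitaev theorem) gives
`D(U, M) ≤ 2ᵐ ε` (through the tree's `implOn_of_opNorm_sub_le`, `ObliviousAmplification.lean`).
[folklore] -/
theorem phaseDist_le_of_opNorm_sub_smul_le {M U : Matrix (QReg m) (QReg m) ℂ} {a : ℂ} (ha : ‖a‖ = 1)
    {ε : ℝ} (hε : 0 ≤ ε) (h : ‖M - a • U‖ ≤ ε) : phaseDist U M ≤ Fintype.card (QReg m) * ε :=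
  phaseDist_le_of_fro_sub_smul_le ha (fro_le_of_implOn hε (implOn_of_opNorm_sub_le Set.univ h))

end OpNorm

/-! ### Relation to Mathlib's scoped Frobenius norm -/

section Frobenius

open scoped Matrix.Norms.Frobenius

/-- **`fro` is Mathlib's (scoped) Frobenius norm** `Matrix.frobeniusNormedAddCommGroup`
(`open scoped Matrix.Norms.Frobenius`; so e.g. `fro_mul_le` is `Matrix.frobenius_norm_mul`), and
`fro X ^ 2` is the tree's `hsNormSq X = ∑ᵢⱼ ‖Xᵢⱼ‖²` of `HilbertSchmidtKraus.lean` by `fro_sq`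
(that file is not imported here to keep the import closure of the compiler files small). [folklore] -/
theorem fro_eq_frobenius_norm (X : Matrix (QReg m) (QReg m) ℂ) : fro X = ‖X‖ := by
  have h1 : ‖X‖ = Real.sqrt (∑ i, ∑ j, ‖X i j‖ ^ 2) := by
    rw [Matrix.frobenius_norm_def, Real.sqrt_eq_rpow]
    congr 1
    refine Finset.sum_congr rfl fun i _ => Finset.sum_congr rfl fun j _ => ?_
    exact Real.rpow_two _
  rw [h1, ← fro_sq, Real.sqrt_sq (fro_nonneg X)]

end Frobenius

end PhaseFrobenius

end Literature.Computability.QuantumComplexity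

end
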